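import Summits.Ventures.HSemireg.WedgeHankelRecurrenceGaussChebyshevDirichletKernel

/-!
# Venture HSemireg — **THE FEJÉR KERNEL IN EVERY COMMUTATIVE RING: `(2 − X)·Σ_{k<n} (S_k + S_{k−1}) = 2 − C_n`, `Σ_{k<2m+1} (S_k + S_{k−1}) = (S_m + S_{m−1})²`, `Σ_{k<2m+2} (S_k + S_{k−1}) = (X + 2)·S_m²`,
# and Fejér positivity `Σ_{k<n} (S_k(x) + S_{k−1}(x)) ≥ 0` for real `x ≥ −2`** (at `x = 2cos θ`: `Σ_{k<n} D_k(θ) = sin²(nθ∕2)∕sin²(θ∕2) = (2 − 2cos nθ)∕(2 − 2cos θ) = n·F_n(θ) ≥ 0`, with the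
# Dirichlet kernels `D_k = S_k + S_{k−1}` of N538 and the differences of squares supplied by the Clebsch–Gordan rule of N537)

HONEST FRAMING. Part of the Lean index of the computation cell `pub-hsemireg` (seat p10 gen 49, Sunday typer «UNIFORM-IN-n»).  Polynomial algebra over a commutative ring (Mathlib
`Polynomial.Chebyshev.S ∕ C`, `Finset.sum`) and one real inequality; no variety, no cohomology theory, no sheaf, no Ext group and no semiregularity map is constructed here; nothing here says that HC /
HC_CM / HC_AV holds; no Literature fact (unproved `Prop`) is declared or used.  Custodian versions as in `WedgeHankelSiegelIdeal` (1/3).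
SOURCES (cited).  L. Fejér, *Untersuchungen über Fouriersche Reihen*, Math. Ann. 58 (1904) 51–69; A. Zygmund, *Trigonometric Series* I (Cambridge 1959), Ch. III §3, (3.2)–(3.4) (`K_n(θ) =
(1∕(n+1)) Σ_{k≤n} D_k(θ) = (1∕(n+1))·(sin((n+1)θ∕2)∕sin(θ∕2))²∕2 ≥ 0`); J. C. Mason, D. C. Handscomb, *Chebyshev Polynomials* (2003), §2.4.3.
PROOF TYPED HERE.  (1) Induction with `(2 − X)(S_n + S_{n−1}) = C_n − C_{n+1}` (`X·S_j = S_{j+1} + S_{j−1}`, N537 `X_mul_chebyshevS`; `C_{j+2} = S_{j+2} − S_j`, N535); (2) induction with the Clebsch–Gordan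
differences `S_{m+1}² − S_m² = S_{2m+2}` and `S_{m+2}S_{m+1} − S_{m+1}S_m = S_{2m+3}` (N537 `chebyshevS_sq_eq_sum`, `chebyshevS_mul_S` and `Finset.sum_range_succ`); (3) the even case with
`(X + 2)(S_{m+1}² − S_m²) = (X + 2)S_{2m+2} = S_{2m+3} + 2S_{2m+2} + S_{2m+1}`; (4) positivity: a square resp. `(x + 2)·square` at `x ≥ −2`, by parity of `n`.
DEDUP DISCLOSURE (`rg -n -i 'fejer|Fejér' Summits/Ventures/HSemireg` — none; `Literature.Analysis.Quadrature.FejerRules` concerns Fejér QUADRATURE rules, not the kernel; 2026-09-04): the half-angle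
factorisations `C_{2m+1} − 2 = (X − 2)(S_m + S_{m−1})²`, `C_{2m} − 2 = (X² − 4)S_{m−1}²` of N478 ∕ N485 are the `(2 − X)`-multiples of (2)–(3) (consistent with (1)); the Fejér sums themselves and
the positivity statement are not typed; 0 hits for the 7 names below.

WHAT IS IN THE TREE.  N535 `chebyshevC_add_two_eq_S_sub_S`; N537 `X_mul_chebyshevS`, `chebyshevS_mul_S`, `chebyshevS_sq_eq_sum`; Mathlib `S_zero ∕ S_one ∕ S_two ∕ S_neg_one`, `C_zero`, `Finset.sum_range_succ`,
`Nat.even_or_odd'`, `eval_finsetSum`.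
THIS FILE (namespace `Summit.Ventures.HSemireg.Wedge.HankelOuter` continued; CHAINED on N538; 0 definitions):
* §1304 **`two_sub_X_mul_sum_dirichlet`** (`(2 − X)Σ_{k<n}(S_k + S_{k−1}) = 2 − C_n`), `chebyshevS_succ_sq_sub_sq` (`S_{m+1}² − S_m² = S_{2m+2}`), `chebyshevS_mul_succ_sub` (`S_{m+2}S_{m+1} − S_{m+1}S_m = S_{2m+3}`),
  **`sum_dirichlet_odd`** (`Σ_{k<2m+1}(S_k + S_{k−1}) = (S_m + S_{m−1})²`), **`sum_dirichlet_even`** (`Σ_{k<2m+2}(S_k + S_{k−1}) = (X + 2)S_m²`), **`sum_dirichlet_eval_nonneg`** (`x ≥ −2` ⇒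
  `0 ≤ Σ_{k<n}(S_k(x) + S_{k−1}(x))`, Fejér positivity), `two_sub_mul_sum_dirichlet_eval` (`(2 − x)Σ = 2 − C_n(x)`).
CAVEATS.  `D_k := S_k + S_{k−1}` is written out (no definition); `n ∈ ℕ`, indices in `ℤ`.  Nothing Ext-side.  New names only.
-/

open Module Polynomial
open scoped Matrix Polynomial

namespace Summit.Ventures.HSemireg.Wedge.HankelOuter

/-! ## §1304. The Fejér kernel `Σ_{k<n} (S_k + S_{k−1})` -/

/-- **`(2 − X)·Σ_{k<n} (S_k + S_{k−1}) = 2 − C_n`** in every commutative ring (`Σ_{k<n} D_k(θ) = (1 − cos nθ)∕(1 − cos θ)`). [Zygmund III (3.2); this file, §1304] -/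
theorem two_sub_X_mul_sum_dirichlet (R : Type*) [CommRing R] (n : ℕ) :
    (2 - X) * ∑ k ∈ Finset.range n, (Polynomial.Chebyshev.S R (k : ℤ) + Polynomial.Chebyshev.S R ((k : ℤ) - 1)) = 2 - Polynomial.Chebyshev.C R (n : ℤ) := by
  induction n with
  | zero => simp
  | succ m ih =>
    rw [Finset.sum_range_succ, mul_add, ih]
    have h1 := X_mul_chebyshevS R (m : ℤ)
    have h2 := X_mul_chebyshevS R ((m : ℤ) - 1)
    have h3 := chebyshevC_add_two_eq_S_sub_S R ((m : ℤ) - 1)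
    have h4 := chebyshevC_add_two_eq_S_sub_S R ((m : ℤ) - 2)
    rw [show (m : ℤ) - 1 + 2 = (m : ℤ) + 1 by ring] at h3
    rw [show (m : ℤ) - 2 + 2 = (m : ℤ) by ring] at h4
    rw [show (m : ℤ) - 1 + 1 = (m : ℤ) by ring, show (m : ℤ) - 1 - 1 = (m : ℤ) - 2 by ring] at h2
    push_cast
    linear_combination (-1 : R[X]) * h1 + (-1 : R[X]) * h2 + h3 - h4

/-- `S_{m+1}² − S_m² = S_{2m+2}` (difference of consecutive Clebsch–Gordan squares, N537). [this file, §1304] -/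
theorem chebyshevS_succ_sq_sub_sq (R : Type*) [CommRing R] (m : ℕ) :
    Polynomial.Chebyshev.S R ((m + 1 : ℕ) : ℤ) ^ 2 - Polynomial.Chebyshev.S R (m : ℤ) ^ 2 = Polynomial.Chebyshev.S R (2 * (m : ℤ) + 2) := by
  rw [chebyshevS_sq_eq_sum, chebyshevS_sq_eq_sum, Finset.sum_range_succ _ (m + 1)]
  push_cast
  rw [show (2 : ℤ) * ((m : ℤ) + 1) = 2 * (m : ℤ) + 2 by ring]
  ring

/-- `S_{m+2}·S_{m+1} − S_{m+1}·S_m = S_{2m+3}` (difference of consecutive Clebsch–Gordan products, N537). [this file, §1304] -/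
theorem chebyshevS_mul_succ_sub (R : Type*) [CommRing R] (m : ℕ) :
    Polynomial.Chebyshev.S R ((m + 2 : ℕ) : ℤ) * Polynomial.Chebyshev.S R ((m + 1 : ℕ) : ℤ) - Polynomial.Chebyshev.S R ((m + 1 : ℕ) : ℤ) * Polynomial.Chebyshev.S R (m : ℤ) =
      Polynomial.Chebyshev.S R (2 * (m : ℤ) + 3) := by
  have h1 := chebyshevS_mul_S R ((m + 2 : ℕ) : ℤ) (m + 1)
  have h2 := chebyshevS_mul_S R ((m + 1 : ℕ) : ℤ) m
  have e1 : ∑ k ∈ Finset.range (m + 1 + 1), Polynomial.Chebyshev.S R (((m + 2 : ℕ) : ℤ) - ((m + 1 : ℕ) : ℤ) + 2 * (k : ℤ)) =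
      ∑ k ∈ Finset.range (m + 1 + 1), Polynomial.Chebyshev.S R (1 + 2 * (k : ℤ)) :=
    Finset.sum_congr rfl fun k _ => by congr 1; push_cast; ring
  have e2 : ∑ k ∈ Finset.range (m + 1), Polynomial.Chebyshev.S R (((m + 1 : ℕ) : ℤ) - (m : ℤ) + 2 * (k : ℤ)) =
      ∑ k ∈ Finset.range (m + 1), Polynomial.Chebyshev.S R (1 + 2 * (k : ℤ)) :=
    Finset.sum_congr rfl fun k _ => by congr 1; push_cast; ring
  rw [h1, h2, e1, e2, Finset.sum_range_succ _ (m + 1)]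
  push_cast
  rw [show (1 : ℤ) + 2 * ((m : ℤ) + 1) = 2 * (m : ℤ) + 3 by ring]
  ring

/-- **`Σ_{k<2m+1} (S_k + S_{k−1}) = (S_m + S_{m−1})²`** in every commutative ring (odd Fejér sum = square of the half-angle polynomial `W_m`; at `x = 2cos θ`: `sin²((2m+1)θ∕2)∕sin²(θ∕2)`).
[Zygmund III (3.4); this file, §1304] -/
theorem sum_dirichlet_odd (R : Type*) [CommRing R] (m : ℕ) :
    ∑ k ∈ Finset.range (2 * m + 1), (Polynomial.Chebyshev.S R (k : ℤ) + Polynomial.Chebyshev.S R ((k : ℤ) - 1)) =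
      (Polynomial.Chebyshev.S R (m : ℤ) + Polynomial.Chebyshev.S R ((m : ℤ) - 1)) ^ 2 := by
  induction m with
  | zero => simp [Polynomial.Chebyshev.S_neg_one]
  | succ m ih =>
    rw [show 2 * (m + 1) + 1 = 2 * m + 1 + 1 + 1 by ring, Finset.sum_range_succ, Finset.sum_range_succ, ih]
    have h3 : Polynomial.Chebyshev.S R ((m + 1 : ℕ) : ℤ) ^ 2 - Polynomial.Chebyshev.S R ((m : ℤ) - 1) ^ 2 =
        Polynomial.Chebyshev.S R (2 * (m : ℤ) + 2) + Polynomial.Chebyshev.S R (2 * (m : ℤ)) := by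
      cases m with
      | zero => simp [Polynomial.Chebyshev.S_neg_one, Polynomial.Chebyshev.S_two]
      | succ p =>
        have h4 := chebyshevS_succ_sq_sub_sq R (p + 1)
        have h5 := chebyshevS_succ_sq_sub_sq R p
        push_cast at h4 h5 ⊢
        linear_combination (norm := ring_nf) h4 + h5
    have h6 : Polynomial.Chebyshev.S R ((m + 1 : ℕ) : ℤ) * Polynomial.Chebyshev.S R (m : ℤ) - Polynomial.Chebyshev.S R (m : ℤ) * Polynomial.Chebyshev.S R ((m : ℤ) - 1) =
        Polynomial.Chebyshev.S R (2 * (m : ℤ) + 1) := by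
      cases m with
      | zero => simp [Polynomial.Chebyshev.S_neg_one]
      | succ p =>
        have h7 := chebyshevS_mul_succ_sub R p
        push_cast at h7 ⊢
        linear_combination (norm := ring_nf) h7
    push_cast at h3 h6 ⊢
    linear_combination (norm := ring_nf) -h3 - 2 * h6

/-- **`Σ_{k<2m+2} (S_k + S_{k−1}) = (X + 2)·S_m²`** in every commutative ring (even Fejér sum; at `x = 2cos θ`: `sin²((m+1)θ)∕sin²(θ∕2) = (2 + 2cos θ)·sin²((m+1)θ)∕sin² θ`).
[Zygmund III (3.4); this file, §1304] -/
theorem sum_dirichlet_even (R : Type*) [CommRing R] (m : ℕ) :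
    ∑ k ∈ Finset.range (2 * m + 2), (Polynomial.Chebyshev.S R (k : ℤ) + Polynomial.Chebyshev.S R ((k : ℤ) - 1)) = (X + 2) * Polynomial.Chebyshev.S R (m : ℤ) ^ 2 := by
  induction m with
  | zero =>
    rw [show 2 * 0 + 2 = 0 + 1 + 1 from rfl, Finset.sum_range_succ, Finset.sum_range_succ, Finset.sum_range_zero]
    push_cast
    simp only [zero_add, Polynomial.Chebyshev.S_neg_one, Polynomial.Chebyshev.S_zero, Polynomial.Chebyshev.S_one]
    ring
  | succ m ih =>
    rw [show 2 * (m + 1) + 2 = 2 * m + 2 + 1 + 1 by ring, Finset.sum_range_succ, Finset.sum_range_succ, ih]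
    have h1 := chebyshevS_succ_sq_sub_sq R m
    have h2 := X_mul_chebyshevS R (2 * (m : ℤ) + 2)
    push_cast at h1 ⊢
    linear_combination (norm := ring_nf) (-(X + 2)) * h1 - h2

/-- `(2 − x)·Σ_{k<n} (S_k(x) + S_{k−1}(x)) = 2 − C_n(x)` for `x` in any commutative ring. [Zygmund III (3.2); this file, §1304] -/
theorem two_sub_mul_sum_dirichlet_eval {R : Type*} [CommRing R] (n : ℕ) (x : R) :
    (2 - x) * ∑ k ∈ Finset.range n, ((Polynomial.Chebyshev.S R (k : ℤ)).eval x + (Polynomial.Chebyshev.S R ((k : ℤ) - 1)).eval x) = 2 - (Polynomial.Chebyshev.C R (n : ℤ)).eval x := by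
  have h := congrArg (Polynomial.eval x) (two_sub_X_mul_sum_dirichlet R n)
  simp only [eval_mul, eval_sub, eval_ofNat, eval_X, eval_finsetSum, eval_add] at h
  exact h

/-- **Fejér positivity: `0 ≤ Σ_{k<n} (S_k(x) + S_{k−1}(x))` for real `x ≥ −2`** (a square for odd `n`, `(x + 2)·S²` for even `n`). [Fejér 1904; Zygmund III (3.4); this file, §1304] -/
theorem sum_dirichlet_eval_nonneg (n : ℕ) {x : ℝ} (hx : -2 ≤ x) :
    0 ≤ ∑ k ∈ Finset.range n, ((Polynomial.Chebyshev.S ℝ (k : ℤ)).eval x + (Polynomial.Chebyshev.S ℝ ((k : ℤ) - 1)).eval x) := by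
  obtain ⟨m, rfl | rfl⟩ := Nat.even_or_odd' n
  · cases m with
    | zero => simp
    | succ p =>
      have h := congrArg (Polynomial.eval x) (sum_dirichlet_even ℝ p)
      rw [show 2 * (p + 1) = 2 * p + 2 by ring]
      simp only [eval_finsetSum, eval_add, eval_mul, eval_pow, eval_X, eval_ofNat] at h
      rw [h]
      exact mul_nonneg (by linarith) (sq_nonneg _)
  · have h := congrArg (Polynomial.eval x) (sum_dirichlet_odd ℝ m)
    simp only [eval_finsetSum, eval_add, eval_pow] at h
    rw [h]
    exact sq_nonneg _

end Summit.Ventures.HSemireg.Wedge.HankelOuter
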